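import Summits.Ventures.FusionMHD.Bench.SAlphaEnclosureStages
import HarnessLib

/-!
# F3 — `s–α` at `(s, α) = (1, 2/5)`: even-solution enclosure transcript, KERNEL CHECK FILE 1/3 (stages 0–16: HOE step test ∧ landing,
# one `decide` per stage, ≈ 5 kernel-s each)
(venture LADDER-GRIDFUSION, rung F3, «#199-cand … PATH W» of gridfusion-lead RULING 9ez (6): «lit-3 socket `not_unstableWitness_of_clockField` +
enclosure + a gridfusion `EChainCert` `check = true` in kernel»; cell `gridfusion`, typed by gridfusion-lit-3 (g13), 2026-08-28; generator =
lit-3's untrusted Lean-interpreter search `scratch/GenSAlphaChain51g.lean` (Taylor tube + padding `2·10⁻²`, a-priori grid `10⁻⁴`, hand-over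
grid `10⁻⁷`); 0 `def … : Prop` facts, 0 kit jobs, no `native_decide`, no floating point.)

-/

open NonemptyInterval
open Literature.Analysis.ODE Literature.Analysis.ValidatedNumerics Literature.Analysis.ValidatedNumerics.ITaylor

namespace Summit.Ventures.FusionMHD.Bench.SAlphaEnclosure

/-- Stage 0: the elementary HOE step test (derived program over `W_0` and `S_0`, inclusion (8.10) ⊆ `S_0`) AND the landing of its
end box in the hand-over box of stage 1 — ONE kernel evaluation. [cite: Moore1979, §8.1 eq. (8.10) with (8.13)] [cite: NedialkovJacksonCorliss1999, §5 Algorithm I] -/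
theorem ok00 : ((st00.toECert sAlphaCode cfg).check && boxLE (st00.toECert sAlphaCode cfg).endBox st01.init) = true := by
  decide +kernel

/-- Stage 0 passes the step test. [cite: Moore1979, §8.1 eq. (8.10) with (8.13)] -/
theorem ok00c : (st00.toECert sAlphaCode cfg).check = true := (Bool.and_eq_true_iff.1 ok00).1

/-- The end box of stage 0 lands in the hand-over box of stage 1. [cite: NedialkovJacksonCorliss1999, §5 Algorithm I] -/
theorem ok00b : boxLE (st00.toECert sAlphaCode cfg).endBox st01.init = true := (Bool.and_eq_true_iff.1 ok00).2

/-- Stage 1: the elementary HOE step test (derived program over `W_1` and `S_1`, inclusion (8.10) ⊆ `S_1`) AND the landing of its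
end box in the hand-over box of stage 2 — ONE kernel evaluation. [cite: Moore1979, §8.1 eq. (8.10) with (8.13)] [cite: NedialkovJacksonCorliss1999, §5 Algorithm I] -/
theorem ok01 : ((st01.toECert sAlphaCode cfg).check && boxLE (st01.toECert sAlphaCode cfg).endBox st02.init) = true := by
  decide +kernel

/-- Stage 1 passes the step test. [cite: Moore1979, §8.1 eq. (8.10) with (8.13)] -/
theorem ok01c : (st01.toECert sAlphaCode cfg).check = true := (Bool.and_eq_true_iff.1 ok01).1

/-- The end box of stage 1 lands in the hand-over box of stage 2. [cite: NedialkovJacksonCorliss1999, §5 Algorithm I] -/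
theorem ok01b : boxLE (st01.toECert sAlphaCode cfg).endBox st02.init = true := (Bool.and_eq_true_iff.1 ok01).2

/-- Stage 2: the elementary HOE step test (derived program over `W_2` and `S_2`, inclusion (8.10) ⊆ `S_2`) AND the landing of its
end box in the hand-over box of stage 3 — ONE kernel evaluation. [cite: Moore1979, §8.1 eq. (8.10) with (8.13)] [cite: NedialkovJacksonCorliss1999, §5 Algorithm I] -/
theorem ok02 : ((st02.toECert sAlphaCode cfg).check && boxLE (st02.toECert sAlphaCode cfg).endBox st03.init) = true := by
  decide +kernel

/-- Stage 2 passes the step test. [cite: Moore1979, §8.1 eq. (8.10) with (8.13)] -/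
theorem ok02c : (st02.toECert sAlphaCode cfg).check = true := (Bool.and_eq_true_iff.1 ok02).1

/-- The end box of stage 2 lands in the hand-over box of stage 3. [cite: NedialkovJacksonCorliss1999, §5 Algorithm I] -/
theorem ok02b : boxLE (st02.toECert sAlphaCode cfg).endBox st03.init = true := (Bool.and_eq_true_iff.1 ok02).2

/-- Stage 3: the elementary HOE step test (derived program over `W_3` and `S_3`, inclusion (8.10) ⊆ `S_3`) AND the landing of its
end box in the hand-over box of stage 4 — ONE kernel evaluation. [cite: Moore1979, §8.1 eq. (8.10) with (8.13)] [cite: NedialkovJacksonCorliss1999, §5 Algorithm I] -/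
theorem ok03 : ((st03.toECert sAlphaCode cfg).check && boxLE (st03.toECert sAlphaCode cfg).endBox st04.init) = true := by
  decide +kernel

/-- Stage 3 passes the step test. [cite: Moore1979, §8.1 eq. (8.10) with (8.13)] -/
theorem ok03c : (st03.toECert sAlphaCode cfg).check = true := (Bool.and_eq_true_iff.1 ok03).1

/-- The end box of stage 3 lands in the hand-over box of stage 4. [cite: NedialkovJacksonCorliss1999, §5 Algorithm I] -/
theorem ok03b : boxLE (st03.toECert sAlphaCode cfg).endBox st04.init = true := (Bool.and_eq_true_iff.1 ok03).2

/-- Stage 4: the elementary HOE step test (derived program over `W_4` and `S_4`, inclusion (8.10) ⊆ `S_4`) AND the landing of its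
end box in the hand-over box of stage 5 — ONE kernel evaluation. [cite: Moore1979, §8.1 eq. (8.10) with (8.13)] [cite: NedialkovJacksonCorliss1999, §5 Algorithm I] -/
theorem ok04 : ((st04.toECert sAlphaCode cfg).check && boxLE (st04.toECert sAlphaCode cfg).endBox st05.init) = true := by
  decide +kernel

/-- Stage 4 passes the step test. [cite: Moore1979, §8.1 eq. (8.10) with (8.13)] -/
theorem ok04c : (st04.toECert sAlphaCode cfg).check = true := (Bool.and_eq_true_iff.1 ok04).1

/-- The end box of stage 4 lands in the hand-over box of stage 5. [cite: NedialkovJacksonCorliss1999, §5 Algorithm I] -/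
theorem ok04b : boxLE (st04.toECert sAlphaCode cfg).endBox st05.init = true := (Bool.and_eq_true_iff.1 ok04).2

/-- Stage 5: the elementary HOE step test (derived program over `W_5` and `S_5`, inclusion (8.10) ⊆ `S_5`) AND the landing of its
end box in the hand-over box of stage 6 — ONE kernel evaluation. [cite: Moore1979, §8.1 eq. (8.10) with (8.13)] [cite: NedialkovJacksonCorliss1999, §5 Algorithm I] -/
theorem ok05 : ((st05.toECert sAlphaCode cfg).check && boxLE (st05.toECert sAlphaCode cfg).endBox st06.init) = true := by
  decide +kernel

/-- Stage 5 passes the step test. [cite: Moore1979, §8.1 eq. (8.10) with (8.13)] -/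
theorem ok05c : (st05.toECert sAlphaCode cfg).check = true := (Bool.and_eq_true_iff.1 ok05).1

/-- The end box of stage 5 lands in the hand-over box of stage 6. [cite: NedialkovJacksonCorliss1999, §5 Algorithm I] -/
theorem ok05b : boxLE (st05.toECert sAlphaCode cfg).endBox st06.init = true := (Bool.and_eq_true_iff.1 ok05).2

/-- Stage 6: the elementary HOE step test (derived program over `W_6` and `S_6`, inclusion (8.10) ⊆ `S_6`) AND the landing of its
end box in the hand-over box of stage 7 — ONE kernel evaluation. [cite: Moore1979, §8.1 eq. (8.10) with (8.13)] [cite: NedialkovJacksonCorliss1999, §5 Algorithm I] -/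
theorem ok06 : ((st06.toECert sAlphaCode cfg).check && boxLE (st06.toECert sAlphaCode cfg).endBox st07.init) = true := by
  decide +kernel

/-- Stage 6 passes the step test. [cite: Moore1979, §8.1 eq. (8.10) with (8.13)] -/
theorem ok06c : (st06.toECert sAlphaCode cfg).check = true := (Bool.and_eq_true_iff.1 ok06).1

/-- The end box of stage 6 lands in the hand-over box of stage 7. [cite: NedialkovJacksonCorliss1999, §5 Algorithm I] -/
theorem ok06b : boxLE (st06.toECert sAlphaCode cfg).endBox st07.init = true := (Bool.and_eq_true_iff.1 ok06).2

/-- Stage 7: the elementary HOE step test (derived program over `W_7` and `S_7`, inclusion (8.10) ⊆ `S_7`) AND the landing of its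
end box in the hand-over box of stage 8 — ONE kernel evaluation. [cite: Moore1979, §8.1 eq. (8.10) with (8.13)] [cite: NedialkovJacksonCorliss1999, §5 Algorithm I] -/
theorem ok07 : ((st07.toECert sAlphaCode cfg).check && boxLE (st07.toECert sAlphaCode cfg).endBox st08.init) = true := by
  decide +kernel

/-- Stage 7 passes the step test. [cite: Moore1979, §8.1 eq. (8.10) with (8.13)] -/
theorem ok07c : (st07.toECert sAlphaCode cfg).check = true := (Bool.and_eq_true_iff.1 ok07).1

/-- The end box of stage 7 lands in the hand-over box of stage 8. [cite: NedialkovJacksonCorliss1999, §5 Algorithm I] -/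
theorem ok07b : boxLE (st07.toECert sAlphaCode cfg).endBox st08.init = true := (Bool.and_eq_true_iff.1 ok07).2

/-- Stage 8: the elementary HOE step test (derived program over `W_8` and `S_8`, inclusion (8.10) ⊆ `S_8`) AND the landing of its
end box in the hand-over box of stage 9 — ONE kernel evaluation. [cite: Moore1979, §8.1 eq. (8.10) with (8.13)] [cite: NedialkovJacksonCorliss1999, §5 Algorithm I] -/
theorem ok08 : ((st08.toECert sAlphaCode cfg).check && boxLE (st08.toECert sAlphaCode cfg).endBox st09.init) = true := by
  decide +kernel

/-- Stage 8 passes the step test. [cite: Moore1979, §8.1 eq. (8.10) with (8.13)] -/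
theorem ok08c : (st08.toECert sAlphaCode cfg).check = true := (Bool.and_eq_true_iff.1 ok08).1

/-- The end box of stage 8 lands in the hand-over box of stage 9. [cite: NedialkovJacksonCorliss1999, §5 Algorithm I] -/
theorem ok08b : boxLE (st08.toECert sAlphaCode cfg).endBox st09.init = true := (Bool.and_eq_true_iff.1 ok08).2

/-- Stage 9: the elementary HOE step test (derived program over `W_9` and `S_9`, inclusion (8.10) ⊆ `S_9`) AND the landing of its
end box in the hand-over box of stage 10 — ONE kernel evaluation. [cite: Moore1979, §8.1 eq. (8.10) with (8.13)] [cite: NedialkovJacksonCorliss1999, §5 Algorithm I] -/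
theorem ok09 : ((st09.toECert sAlphaCode cfg).check && boxLE (st09.toECert sAlphaCode cfg).endBox st10.init) = true := by
  decide +kernel

/-- Stage 9 passes the step test. [cite: Moore1979, §8.1 eq. (8.10) with (8.13)] -/
theorem ok09c : (st09.toECert sAlphaCode cfg).check = true := (Bool.and_eq_true_iff.1 ok09).1

/-- The end box of stage 9 lands in the hand-over box of stage 10. [cite: NedialkovJacksonCorliss1999, §5 Algorithm I] -/
theorem ok09b : boxLE (st09.toECert sAlphaCode cfg).endBox st10.init = true := (Bool.and_eq_true_iff.1 ok09).2

/-- Stage 10: the elementary HOE step test (derived program over `W_10` and `S_10`, inclusion (8.10) ⊆ `S_10`) AND the landing of its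
end box in the hand-over box of stage 11 — ONE kernel evaluation. [cite: Moore1979, §8.1 eq. (8.10) with (8.13)] [cite: NedialkovJacksonCorliss1999, §5 Algorithm I] -/
theorem ok10 : ((st10.toECert sAlphaCode cfg).check && boxLE (st10.toECert sAlphaCode cfg).endBox st11.init) = true := by
  decide +kernel

/-- Stage 10 passes the step test. [cite: Moore1979, §8.1 eq. (8.10) with (8.13)] -/
theorem ok10c : (st10.toECert sAlphaCode cfg).check = true := (Bool.and_eq_true_iff.1 ok10).1

/-- The end box of stage 10 lands in the hand-over box of stage 11. [cite: NedialkovJacksonCorliss1999, §5 Algorithm I] -/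
theorem ok10b : boxLE (st10.toECert sAlphaCode cfg).endBox st11.init = true := (Bool.and_eq_true_iff.1 ok10).2

/-- Stage 11: the elementary HOE step test (derived program over `W_11` and `S_11`, inclusion (8.10) ⊆ `S_11`) AND the landing of its
end box in the hand-over box of stage 12 — ONE kernel evaluation. [cite: Moore1979, §8.1 eq. (8.10) with (8.13)] [cite: NedialkovJacksonCorliss1999, §5 Algorithm I] -/
theorem ok11 : ((st11.toECert sAlphaCode cfg).check && boxLE (st11.toECert sAlphaCode cfg).endBox st12.init) = true := by
  decide +kernel

/-- Stage 11 passes the step test. [cite: Moore1979, §8.1 eq. (8.10) with (8.13)] -/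
theorem ok11c : (st11.toECert sAlphaCode cfg).check = true := (Bool.and_eq_true_iff.1 ok11).1

/-- The end box of stage 11 lands in the hand-over box of stage 12. [cite: NedialkovJacksonCorliss1999, §5 Algorithm I] -/
theorem ok11b : boxLE (st11.toECert sAlphaCode cfg).endBox st12.init = true := (Bool.and_eq_true_iff.1 ok11).2

/-- Stage 12: the elementary HOE step test (derived program over `W_12` and `S_12`, inclusion (8.10) ⊆ `S_12`) AND the landing of its
end box in the hand-over box of stage 13 — ONE kernel evaluation. [cite: Moore1979, §8.1 eq. (8.10) with (8.13)] [cite: NedialkovJacksonCorliss1999, §5 Algorithm I] -/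
theorem ok12 : ((st12.toECert sAlphaCode cfg).check && boxLE (st12.toECert sAlphaCode cfg).endBox st13.init) = true := by
  decide +kernel

/-- Stage 12 passes the step test. [cite: Moore1979, §8.1 eq. (8.10) with (8.13)] -/
theorem ok12c : (st12.toECert sAlphaCode cfg).check = true := (Bool.and_eq_true_iff.1 ok12).1

/-- The end box of stage 12 lands in the hand-over box of stage 13. [cite: NedialkovJacksonCorliss1999, §5 Algorithm I] -/
theorem ok12b : boxLE (st12.toECert sAlphaCode cfg).endBox st13.init = true := (Bool.and_eq_true_iff.1 ok12).2

/-- Stage 13: the elementary HOE step test (derived program over `W_13` and `S_13`, inclusion (8.10) ⊆ `S_13`) AND the landing of its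
end box in the hand-over box of stage 14 — ONE kernel evaluation. [cite: Moore1979, §8.1 eq. (8.10) with (8.13)] [cite: NedialkovJacksonCorliss1999, §5 Algorithm I] -/
theorem ok13 : ((st13.toECert sAlphaCode cfg).check && boxLE (st13.toECert sAlphaCode cfg).endBox st14.init) = true := by
  decide +kernel

/-- Stage 13 passes the step test. [cite: Moore1979, §8.1 eq. (8.10) with (8.13)] -/
theorem ok13c : (st13.toECert sAlphaCode cfg).check = true := (Bool.and_eq_true_iff.1 ok13).1

/-- The end box of stage 13 lands in the hand-over box of stage 14. [cite: NedialkovJacksonCorliss1999, §5 Algorithm I] -/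
theorem ok13b : boxLE (st13.toECert sAlphaCode cfg).endBox st14.init = true := (Bool.and_eq_true_iff.1 ok13).2

/-- Stage 14: the elementary HOE step test (derived program over `W_14` and `S_14`, inclusion (8.10) ⊆ `S_14`) AND the landing of its
end box in the hand-over box of stage 15 — ONE kernel evaluation. [cite: Moore1979, §8.1 eq. (8.10) with (8.13)] [cite: NedialkovJacksonCorliss1999, §5 Algorithm I] -/
theorem ok14 : ((st14.toECert sAlphaCode cfg).check && boxLE (st14.toECert sAlphaCode cfg).endBox st15.init) = true := by
  decide +kernel

/-- Stage 14 passes the step test. [cite: Moore1979, §8.1 eq. (8.10) with (8.13)] -/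
theorem ok14c : (st14.toECert sAlphaCode cfg).check = true := (Bool.and_eq_true_iff.1 ok14).1

/-- The end box of stage 14 lands in the hand-over box of stage 15. [cite: NedialkovJacksonCorliss1999, §5 Algorithm I] -/
theorem ok14b : boxLE (st14.toECert sAlphaCode cfg).endBox st15.init = true := (Bool.and_eq_true_iff.1 ok14).2

/-- Stage 15: the elementary HOE step test (derived program over `W_15` and `S_15`, inclusion (8.10) ⊆ `S_15`) AND the landing of its
end box in the hand-over box of stage 16 — ONE kernel evaluation. [cite: Moore1979, §8.1 eq. (8.10) with (8.13)] [cite: NedialkovJacksonCorliss1999, §5 Algorithm I] -/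
theorem ok15 : ((st15.toECert sAlphaCode cfg).check && boxLE (st15.toECert sAlphaCode cfg).endBox st16.init) = true := by
  decide +kernel

/-- Stage 15 passes the step test. [cite: Moore1979, §8.1 eq. (8.10) with (8.13)] -/
theorem ok15c : (st15.toECert sAlphaCode cfg).check = true := (Bool.and_eq_true_iff.1 ok15).1

/-- The end box of stage 15 lands in the hand-over box of stage 16. [cite: NedialkovJacksonCorliss1999, §5 Algorithm I] -/
theorem ok15b : boxLE (st15.toECert sAlphaCode cfg).endBox st16.init = true := (Bool.and_eq_true_iff.1 ok15).2

/-- Stage 16: the elementary HOE step test (derived program over `W_16` and `S_16`, inclusion (8.10) ⊆ `S_16`) AND the landing of its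
end box in the hand-over box of stage 17 — ONE kernel evaluation. [cite: Moore1979, §8.1 eq. (8.10) with (8.13)] [cite: NedialkovJacksonCorliss1999, §5 Algorithm I] -/
theorem ok16 : ((st16.toECert sAlphaCode cfg).check && boxLE (st16.toECert sAlphaCode cfg).endBox st17.init) = true := by
  decide +kernel

/-- Stage 16 passes the step test. [cite: Moore1979, §8.1 eq. (8.10) with (8.13)] -/
theorem ok16c : (st16.toECert sAlphaCode cfg).check = true := (Bool.and_eq_true_iff.1 ok16).1

/-- The end box of stage 16 lands in the hand-over box of stage 17. [cite: NedialkovJacksonCorliss1999, §5 Algorithm I] -/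
theorem ok16b : boxLE (st16.toECert sAlphaCode cfg).endBox st17.init = true := (Bool.and_eq_true_iff.1 ok16).2

end Summit.Ventures.FusionMHD.Bench.SAlphaEnclosure
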